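import Mathlib
import Summits.Schanuel.Schanuel.Statement
import Literature.NumberTheory.Transcendental.RoyCriterion
import Literature.NumberTheory.Transcendental.RoyCriterionProofs
import Literature.NumberTheory.Transcendental.RoyCriterionThm3Proofs
import Summits.Schanuel.Schanuel.Theorems.SoloBlindJetBoxPrinciple
import Summits.Schanuel.Schanuel.Theorems.SoloBlindSubDirichletCount
import Summits.Schanuel.Schanuel.Theorems.SoloBlindSubDirichlet
import HarnessLib

/-!
# Roy's jets are void on every sparse point set — the load-bearing translates are many

`Summits/Schanuel/Schanuel/Theorems/SoloBlindJetPointSets.lean` (soloist `solo-Schanuel-blind`,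
session 16).

`SoloBlindSubDirichlet.lean` proved that the hypothesis of Roy's Conjecture 2 (Acta Arith. 97
(2001); `RoyHypothesis y α s₀ s₁ t₀ t₁ u`: `0 ≠ P_N ∈ ℤ[X₀,X₁]`, `deg ≤ (N^{t₀}, N^{t₁})`,
`H ≤ e^N`, `|(D^k P_N)(m·y, α^m)| ≤ e^{−N^u}` for `k ≤ N^{s₀}`, `m ∈ [0, N^{s₁}]^l`) holds at EVERY
`(y, α)` as soon as the count of conditions is sub-Dirichlet, `s₀ + l s₁ + u < 1 + t₀ + t₁`.  That
statement is about the full translation BOX.  Here the box is replaced by an ARBITRARY finite set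
of points, and only its cardinality and its size enter:

* `royJets_void_of_pointCount`: let `s₀, s₁, t₁ ≥ 0`, `σ ∈ ℝ`, `u ≥ 1`, `max(s₀, t₀, s₁ + t₁) ≤ u`
  (Roy's side conditions in weak form) and `s₀ + σ + u < 1 + t₀ + t₁`.  Then for all large `N`
  and EVERY finite `S ⊂ ℂ × ℂ` with `#S ≤ N^σ` lying in the region `‖ξ‖ ≤ c N^{s₁}`,
  `‖η‖ ≤ e^{c N^{s₁}}` (the region of Roy's box for `(y, e^y)`), there is `0 ≠ P_N` of Roy's
  profile whose `D`-jets of depth `N^{s₀}` are `≤ e^{−N^u}` at every point of `S`.  No relation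
  between the points, or between the points and the exponential map, is assumed.
* `royJets_void_sparseTranslates`: in particular, for every `y, α ∈ ℂ^l` and every family
  `𝓜_N ⊂ [0, N^{s₁}]^l` of at most `N^σ` translation vectors, Roy's hypothesis RESTRICTED to the
  translates `m ∈ 𝓜_N` holds — whatever the arithmetic or the geometry of `𝓜_N` (lacunary,
  polynomially sparse, random, an arithmetic progression, a sub-box).
* On Roy's window (`RoyAdmissible`): the sparse-translate exponent
  `σ* = 1 + t₀ + t₁ − u − s₀` is positive and smaller than `s₁` (`sparseExponent_pos`,
  `sparseExponent_lt`), and `royJets_void_sparseTranslates_of_admissible`: every family of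
  `≤ N^σ` translates with `σ < σ*` is void at every `(y, α)`, in every rank `l`.

Reading for the summit.  Together with `dirichletExcess_pos_of_royAdmissible` (the genuine
hypothesis always has positive excess) this locates the content of Conjecture 2 — equivalently
(Roy) of Schanuel's conjecture — quantitatively: a proof must use at least `N^{σ*}` of the
`N^{l s₁}` translates at once, and (by `SoloBlindOrbitCommonZeros.lean`,
`SoloBlindProfileCriteriaRefuted.lean`) not their number alone but the group law relating them;
below `N^{σ*}` points the `D`-jets of an integer polynomial of Roy's profile can be prescribed
small anywhere in the region, by Dirichlet's box principle alone.  (Ingredients: the box principle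
for jets at a finite point set `exists_polyOfCoeffs_jets_le` and the range bound `jetRange_le_exp`
of the earlier files; new here is only the point-count bookkeeping `eventually_pointCount_lt`.)

References: D. Roy, *An arithmetic criterion for the values of the exponential function*, Acta
Arith. 97 (2001) 183–194 (Conjecture 2, condition (1)); M. Waldschmidt, *Diophantine approximation
on linear algebraic groups*, Grundlehren 326 (2000), §15.4 (Roy's programme).
-/

noncomputable section

open Filter Complex MvPolynomial Metric

namespace Summit.Schanuel.Schanuel.Theorems

open Literature.NumberTheory.Transcendental

/-! ### Bookkeeping -/

/-- For `x ≥ 1`, `x ≤ 2⌊x⌋₊`. [folklore] -/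
theorem le_two_mul_natFloor {x : ℝ} (hx : 1 ≤ x) : x ≤ 2 * (⌊x⌋₊ : ℝ) := by
  have h1 : (1 : ℝ) ≤ (⌊x⌋₊ : ℝ) := by exact_mod_cast Nat.floor_pos.mpr hx
  have h2 : x < (⌊x⌋₊ : ℝ) + 1 := Nat.lt_floor_add_one x
  by_cases h : x < 2
  · linarith
  · have h' : 2 ≤ x := not_lt.mp h
    linarith

/-- **The count below the Dirichlet exponent, for a point set of cardinality `n ≤ N^σ`.**  Under
the hypotheses of `jetRange_le_exp` and `s₀ + σ + u < 1 + t₀ + t₁`, for all large `N`: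
`ℓ^{2(K+1)n} < (X+1)^{(T₀+1)(T₁+1)}` for `T₀ = ⌊N^{t₀}⌋`, `T₁ = ⌊N^{t₁}⌋`, `K ≤ N^{s₀}`,
`M ≤ N^{s₁}`, `n ≤ N^σ`, `X ≥ ⌊e^N⌋`, `1 ≤ ℓ ≤ 3e^N·K!(T₀+1)(T₁+1)(Mc+1)^{T₀}(a^Me)^{T₁}·e^{N^u}`
— more integer polynomials of Roy's profile than boxes for `2(K+1)n` real jet forms.
(`eventually_subDirichlet_count` is the case `n = (M+1)^l`, `σ = l s₁`.) [this work] -/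
theorem eventually_pointCount_lt {σ s₀ s₁ t₀ t₁ u : ℝ} (hs₀ : 0 ≤ s₀) (hs₁ : 0 ≤ s₁) (ht₁ : 0 ≤ t₁) (hu : 1 ≤ u) (hs₀u : s₀ ≤ u) (ht₀u : t₀ ≤ u)
    (hst : s₁ + t₁ ≤ u) (hdir : s₀ + σ + u < 1 + t₀ + t₁) {c a : ℝ} (hc : 0 ≤ c)
    (ha : 1 ≤ a) :
    ∀ᶠ N : ℕ in atTop, ∀ (T₀ T₁ K M X ℓ n : ℕ),
      (T₀ : ℝ) ≤ (N : ℝ) ^ t₀ → (N : ℝ) ^ t₀ < T₀ + 1 → (T₁ : ℝ) ≤ (N : ℝ) ^ t₁ →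
      (N : ℝ) ^ t₁ < T₁ + 1 → (K : ℝ) ≤ (N : ℝ) ^ s₀ → (M : ℝ) ≤ (N : ℝ) ^ s₁ →
      (n : ℝ) ≤ (N : ℝ) ^ σ → Real.exp N < X + 1 → 0 < ℓ →
      (ℓ : ℝ) ≤ 3 * Real.exp N * (K.factorial * ((((T₀ + 1) * (T₁ + 1) : ℕ) : ℝ) *
          (((M : ℝ) * c + 1) ^ T₀ * (a ^ M * Real.exp 1) ^ T₁))) * Real.exp ((N : ℝ) ^ u) →
      ℓ ^ (2 * ((K + 1) * n)) < (X + 1) ^ ((T₀ + 1) * (T₁ + 1)) := by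
  set C₁ : ℝ := 8 + 2 * u + Real.log (1 + c) + Real.log a with hC₁
  have hC₁0 : 0 ≤ C₁ := by
    have := Real.log_nonneg (by linarith : (1 : ℝ) ≤ 1 + c)
    have := Real.log_nonneg ha
    rw [hC₁]; linarith
  have hev := eventually_mul_rpow_mul_log_le hdir (show (0 : ℝ) ≤ 4 * C₁ by positivity) one_pos
  filter_upwards [tendsto_natCast_atTop_atTop.eventually hev, eventually_ge_atTop 3] with N hN hN3
  intro T₀ T₁ K M X ℓ n hT₀ hT₀' hT₁ hT₁' hK hM hn hX hℓ hℓle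
  have hN3r : (3 : ℝ) ≤ N := by exact_mod_cast hN3
  have hN1 : (1 : ℝ) ≤ N := by linarith
  have hNpos : (0 : ℝ) < N := by linarith
  have hN' : 4 * C₁ * (N : ℝ) ^ (s₀ + σ + u) * Real.log N ≤ 1 * (N : ℝ) ^ (1 + t₀ + t₁) := hN
  -- (i) `log ℓ ≤ C₁ N^u log N`
  have hi : Real.log ℓ ≤ C₁ * ((N : ℝ) ^ u * Real.log N) := by
    rw [Real.log_le_iff_le_exp (by exact_mod_cast hℓ)]
    exact hℓle.trans (jetRange_le_exp hs₀ hs₁ ht₁ hu hs₀u ht₀u hst hc ha hN3 hT₀ hT₁ hK hM)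
  -- (ii) `2(K+1)n ≤ 4 N^{s₀ + σ}`
  have hii : ((2 * ((K + 1) * n) : ℕ) : ℝ) ≤ 4 * (N : ℝ) ^ (s₀ + σ) := by
    have h1 : (1 : ℝ) ≤ (N : ℝ) ^ s₀ := Real.one_le_rpow hN1 hs₀
    have hK1 : (K : ℝ) + 1 ≤ 2 * (N : ℝ) ^ s₀ := by linarith
    have hn0 : (0 : ℝ) ≤ n := Nat.cast_nonneg n
    push_cast
    calc (2 : ℝ) * (((K : ℝ) + 1) * (n : ℝ)) ≤ 2 * ((2 * (N : ℝ) ^ s₀) * (N : ℝ) ^ σ) :=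
          mul_le_mul_of_nonneg_left (mul_le_mul hK1 hn hn0 (by positivity)) (by norm_num)
      _ = 4 * ((N : ℝ) ^ s₀ * (N : ℝ) ^ σ) := by ring
      _ = 4 * (N : ℝ) ^ (s₀ + σ) := by rw [← Real.rpow_add hNpos]
  -- (iii) `N^{1+t₀+t₁} < (T₀+1)(T₁+1) log(X+1)`
  have hiii : (N : ℝ) ^ (1 + t₀ + t₁) <
      (((T₀ + 1) * (T₁ + 1) : ℕ) : ℝ) * Real.log ((X : ℝ) + 1) := by
    have hX0 : (0 : ℝ) ≤ X := Nat.cast_nonneg X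
    have hlog : (N : ℝ) < Real.log ((X : ℝ) + 1) := by
      rw [Real.lt_log_iff_exp_lt (by positivity)]; exact hX
    have hlog0 : 0 ≤ Real.log ((X : ℝ) + 1) := Real.log_nonneg (by linarith)
    have e1 : (N : ℝ) ^ (1 + t₀ + t₁) = N * ((N : ℝ) ^ t₀ * (N : ℝ) ^ t₁) := by
      rw [Real.rpow_add hNpos, Real.rpow_add hNpos, Real.rpow_one]; ring
    have ht0pos : (0 : ℝ) < (N : ℝ) ^ t₀ := Real.rpow_pos_of_pos hNpos _
    have ht1pos : (0 : ℝ) < (N : ℝ) ^ t₁ := Real.rpow_pos_of_pos hNpos _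
    rw [e1]
    push_cast
    calc (N : ℝ) * ((N : ℝ) ^ t₀ * (N : ℝ) ^ t₁)
        < Real.log ((X : ℝ) + 1) * ((N : ℝ) ^ t₀ * (N : ℝ) ^ t₁) :=
          mul_lt_mul_of_pos_right hlog (by positivity)
      _ ≤ Real.log ((X : ℝ) + 1) * (((T₀ : ℝ) + 1) * ((T₁ : ℝ) + 1)) :=
          mul_le_mul_of_nonneg_left (mul_le_mul hT₀'.le hT₁'.le ht1pos.le (by positivity)) hlog0
      _ = ((T₀ : ℝ) + 1) * ((T₁ : ℝ) + 1) * Real.log ((X : ℝ) + 1) := by ring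
  -- combine and exponentiate
  have hℓr : (0 : ℝ) < ℓ := by exact_mod_cast hℓ
  have hlogℓ : 0 ≤ Real.log ℓ := Real.log_nonneg (by exact_mod_cast hℓ)
  have hmain : ((2 * ((K + 1) * n) : ℕ) : ℝ) * Real.log ℓ <
      (((T₀ + 1) * (T₁ + 1) : ℕ) : ℝ) * Real.log ((X : ℝ) + 1) := by
    calc ((2 * ((K + 1) * n) : ℕ) : ℝ) * Real.log ℓ
        ≤ (4 * (N : ℝ) ^ (s₀ + σ)) * (C₁ * ((N : ℝ) ^ u * Real.log N)) :=
          mul_le_mul hii hi hlogℓ (by positivity)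
      _ = 4 * C₁ * (N : ℝ) ^ (s₀ + σ + u) * Real.log N := by
          rw [Real.rpow_add hNpos _ u]; ring
      _ ≤ 1 * (N : ℝ) ^ (1 + t₀ + t₁) := hN'
      _ < _ := by rw [one_mul]; exact hiii
  have hreal : (ℓ : ℝ) ^ (2 * ((K + 1) * n)) < ((X : ℝ) + 1) ^ ((T₀ + 1) * (T₁ + 1)) := by
    rw [← Real.exp_log hℓr, ← Real.exp_nat_mul,
      ← Real.exp_log (by positivity : (0 : ℝ) < (X : ℝ) + 1), ← Real.exp_nat_mul, Real.exp_lt_exp]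
    exact hmain
  exact_mod_cast hreal

/-! ### Jets at an arbitrary sparse point set -/

/-- **Roy's jets are void at every sparse point set.**  Let `s₀, s₁, t₁ ≥ 0`, `u ≥ 1`, `σ ∈ ℝ`,
`max(s₀, t₀, s₁ + t₁) ≤ u` and `s₀ + σ + u < 1 + t₀ + t₁`, and let `c ≥ 0`.  For all large `N`
and EVERY finite `S ⊂ ℂ × ℂ` with `#S ≤ N^σ`, `‖ξ‖ ≤ c N^{s₁}` and `‖η‖ ≤ e^{c N^{s₁}}` for
`(ξ, η) ∈ S`, there is `0 ≠ P_N ∈ ℤ[X₀, X₁]` with `deg_{X₀} P_N ≤ N^{t₀}`, `deg_{X₁} P_N ≤ N^{t₁}`,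
`H(P_N) ≤ e^N` and `|(D^k P_N)(ξ, η)| ≤ e^{−N^u}` for all `k ≤ N^{s₀}` and all `(ξ, η) ∈ S`
(`D = ∂₀ + X₁∂₁`).  Nothing relates the points to each other or to the exponential map: the
`2(⌊N^{s₀}⌋+1)·#S` real jet forms have fewer boxes than there are coefficient vectors
(`exists_polyOfCoeffs_jets_le`, `eventually_pointCount_lt`). [this work] -/
theorem royJets_void_of_pointCount {σ s₀ s₁ t₀ t₁ u : ℝ} (hs₀ : 0 ≤ s₀) (hs₁ : 0 ≤ s₁) (ht₁ : 0 ≤ t₁) (hu : 1 ≤ u) (hs₀u : s₀ ≤ u) (ht₀u : t₀ ≤ u)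
    (hst : s₁ + t₁ ≤ u) (hdir : s₀ + σ + u < 1 + t₀ + t₁) {c : ℝ} (hc : 0 ≤ c) :
    ∀ᶠ N : ℕ in atTop, ∀ S : Finset (ℂ × ℂ), (S.card : ℝ) ≤ (N : ℝ) ^ σ →
      (∀ p ∈ S, ‖p.1‖ ≤ c * (N : ℝ) ^ s₁) → (∀ p ∈ S, ‖p.2‖ ≤ Real.exp (c * (N : ℝ) ^ s₁)) →
      ∃ P : MvPolynomial (Fin 2) ℤ, P ≠ 0 ∧ (P.degreeOf 0 : ℝ) ≤ (N : ℝ) ^ t₀ ∧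
        (P.degreeOf 1 : ℝ) ≤ (N : ℝ) ^ t₁ ∧ (mvPolyHeight P : ℝ) ≤ Real.exp N ∧
        ∀ k : ℕ, (k : ℝ) ≤ (N : ℝ) ^ s₀ → ∀ p ∈ S,
          ‖aeval ![p.1, p.2] (royD^[k] P)‖ ≤ Real.exp (-(N : ℝ) ^ u) := by
  classical
  set c' : ℝ := 2 * c with hc'_def
  have hc' : 0 ≤ c' := by rw [hc'_def]; positivity
  set a : ℝ := Real.exp (2 * c) with ha_def
  have ha : 1 ≤ a := Real.one_le_exp (by positivity)
  have he1 : (1 : ℝ) ≤ Real.exp 1 := by have := Real.add_one_le_exp (1 : ℝ); linarith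
  filter_upwards [eventually_pointCount_lt hs₀ hs₁ ht₁ hu hs₀u ht₀u hst hdir hc' ha,
    eventually_ge_atTop 1] with N hN hN1n
  intro S hS hξ hη
  have hN0 : (0 : ℝ) ≤ N := Nat.cast_nonneg N
  have hN1 : (1 : ℝ) ≤ N := by exact_mod_cast hN1n
  -- the parameters
  set T₀ : ℕ := ⌊(N : ℝ) ^ t₀⌋₊ with hT₀_def
  set T₁ : ℕ := ⌊(N : ℝ) ^ t₁⌋₊ with hT₁_def
  set K : ℕ := ⌊(N : ℝ) ^ s₀⌋₊ with hK_def
  set M : ℕ := ⌊(N : ℝ) ^ s₁⌋₊ with hM_def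
  set X : ℕ := ⌊Real.exp N⌋₊ with hX_def
  have hT₀ : (T₀ : ℝ) ≤ (N : ℝ) ^ t₀ := Nat.floor_le (Real.rpow_nonneg hN0 _)
  have hT₀' : (N : ℝ) ^ t₀ < T₀ + 1 := Nat.lt_floor_add_one _
  have hT₁ : (T₁ : ℝ) ≤ (N : ℝ) ^ t₁ := Nat.floor_le (Real.rpow_nonneg hN0 _)
  have hT₁' : (N : ℝ) ^ t₁ < T₁ + 1 := Nat.lt_floor_add_one _
  have hK : (K : ℝ) ≤ (N : ℝ) ^ s₀ := Nat.floor_le (Real.rpow_nonneg hN0 _)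
  have hM : (M : ℝ) ≤ (N : ℝ) ^ s₁ := Nat.floor_le (Real.rpow_nonneg hN0 _)
  have hMhalf : (N : ℝ) ^ s₁ ≤ 2 * (M : ℝ) := le_two_mul_natFloor (Real.one_le_rpow hN1 hs₁)
  have hXle : (X : ℝ) ≤ Real.exp N := Nat.floor_le (Real.exp_pos _).le
  have hX : Real.exp N < X + 1 := Nat.lt_floor_add_one _
  set A : ℝ := K.factorial * ((((T₀ + 1) * (T₁ + 1) : ℕ) : ℝ) *
    (((M : ℝ) * c' + 1) ^ T₀ * (a ^ M * Real.exp 1) ^ T₁)) with hA_def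
  have hR₁1 : 1 ≤ a ^ M * Real.exp 1 := one_le_mul_of_one_le_of_one_le (one_le_pow₀ ha) he1
  have hA1 : 1 ≤ A := by
    have h1 : (1 : ℝ) ≤ K.factorial := by exact_mod_cast Nat.succ_le_of_lt (Nat.factorial_pos K)
    have h2 : (1 : ℝ) ≤ (((T₀ + 1) * (T₁ + 1) : ℕ) : ℝ) := by
      exact_mod_cast Nat.succ_le_of_lt (by positivity)
    have h3 : (1 : ℝ) ≤ ((M : ℝ) * c' + 1) ^ T₀ :=
      one_le_pow₀ (by nlinarith [mul_nonneg (Nat.cast_nonneg M) hc'])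
    have h4 : (1 : ℝ) ≤ (a ^ M * Real.exp 1) ^ T₁ := one_le_pow₀ hR₁1
    exact one_le_mul_of_one_le_of_one_le h1
      (one_le_mul_of_one_le_of_one_le h2 (one_le_mul_of_one_le_of_one_le h3 h4))
  have hA0 : 0 ≤ A := zero_le_one.trans hA1
  set ℓ : ℕ := ⌊2 * (X : ℝ) * A * Real.exp ((N : ℝ) ^ u)⌋₊ + 1 with hℓ_def
  have hℓpos : 0 < ℓ := Nat.succ_pos _
  have hℓgt : 2 * (X : ℝ) * A * Real.exp ((N : ℝ) ^ u) < ℓ := by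
    rw [hℓ_def]; push_cast; exact Nat.lt_floor_add_one _
  have hℓle : (ℓ : ℝ) ≤ 3 * Real.exp N * A * Real.exp ((N : ℝ) ^ u) := by
    have h1 : (ℓ : ℝ) ≤ 2 * (X : ℝ) * A * Real.exp ((N : ℝ) ^ u) + 1 := by
      rw [hℓ_def]; push_cast
      linarith [Nat.floor_le (show 0 ≤ 2 * (X : ℝ) * A * Real.exp ((N : ℝ) ^ u) by positivity)]
    have h2 : (1 : ℝ) ≤ Real.exp N * A * Real.exp ((N : ℝ) ^ u) :=
      one_le_mul_of_one_le_of_one_le (one_le_mul_of_one_le_of_one_le (Real.one_le_exp hN0) hA1)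
        (Real.one_le_exp (Real.rpow_nonneg hN0 _))
    have h3 : 2 * (X : ℝ) * A * Real.exp ((N : ℝ) ^ u) ≤
        2 * Real.exp N * A * Real.exp ((N : ℝ) ^ u) := by gcongr
    linarith
  have hcnt := hN T₀ T₁ K M X ℓ S.card hT₀ hT₀' hT₁ hT₁' hK hM hS hX hℓpos hℓle
  -- the points, indexed by the subtype of `S`
  set ξ : {p : ℂ × ℂ // p ∈ S} → ℂ := fun i => i.1.1 with hξ_def
  set η : {p : ℂ × ℂ // p ∈ S} → ℂ := fun i => i.1.2 with hη_def
  have hR : ∀ i, ‖ξ i‖ ≤ M * c' := fun i =>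
    calc ‖ξ i‖ ≤ c * (N : ℝ) ^ s₁ := hξ _ i.2
      _ ≤ c * (2 * (M : ℝ)) := mul_le_mul_of_nonneg_left hMhalf hc
      _ = M * c' := by rw [hc'_def]; ring
  have hR₁ : ∀ i, ‖η i‖ * Real.exp 1 ≤ a ^ M * Real.exp 1 := by
    intro i
    refine mul_le_mul_of_nonneg_right ?_ (Real.exp_pos 1).le
    calc ‖η i‖ ≤ Real.exp (c * (N : ℝ) ^ s₁) := hη _ i.2
      _ ≤ Real.exp (c * (2 * (M : ℝ))) := Real.exp_le_exp.2 (mul_le_mul_of_nonneg_left hMhalf hc)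
      _ = a ^ M := by rw [ha_def, ← Real.exp_nat_mul]; ring_nf
  have hcard : Fintype.card {p : ℂ × ℂ // p ∈ S} = S.card := by simp
  obtain ⟨t, ht0, htX, hjets⟩ := exists_polyOfCoeffs_jets_le ξ η T₀ T₁ K X ℓ hR hR₁ hR₁1 hℓpos
    (by rw [hcard]; exact hcnt)
  refine ⟨polyOfCoeffs t, polyOfCoeffs_ne_zero ht0, ?_, ?_, ?_, ?_⟩
  · calc ((polyOfCoeffs t).degreeOf 0 : ℝ) ≤ T₀ := by exact_mod_cast degreeOf_polyOfCoeffs_fst t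
      _ ≤ (N : ℝ) ^ t₀ := hT₀
  · calc ((polyOfCoeffs t).degreeOf 1 : ℝ) ≤ T₁ := by exact_mod_cast degreeOf_polyOfCoeffs_snd t
      _ ≤ (N : ℝ) ^ t₁ := hT₁
  · have htX' : ∀ i, |(t i : ℝ)| ≤ X := fun i => by
      rw [← Int.cast_abs]; exact_mod_cast htX i
    have htnorm : ‖t‖ ≤ X := by
      refine (pi_norm_le_iff_of_nonneg (by positivity)).2 fun i => ?_
      rw [Int.norm_eq_abs]
      exact htX' i
    exact (mvPolyHeight_polyOfCoeffs_le t).trans (htnorm.trans hXle)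
  · intro k hk p hp
    have hkK : k ≤ K := Nat.le_floor hk
    set i : {p : ℂ × ℂ // p ∈ S} := ⟨p, hp⟩ with hi_def
    have hpt : (![p.1, p.2] : Fin 2 → ℂ) = ![ξ i, η i] := rfl
    rw [hpt]
    have hℓr : (0 : ℝ) < ℓ := by exact_mod_cast hℓpos
    calc ‖aeval ![ξ i, η i] (royD^[k] (polyOfCoeffs t))‖ ≤ 2 * (X * A / ℓ) := hjets k hkK i
      _ = 2 * X * A / ℓ := by ring
      _ ≤ Real.exp (-(N : ℝ) ^ u) := by
          rw [div_le_iff₀ hℓr]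
          calc 2 * (X : ℝ) * A
              = 2 * X * A * Real.exp ((N : ℝ) ^ u) * Real.exp (-(N : ℝ) ^ u) := by
                rw [mul_assoc (2 * X * A), ← Real.exp_add, add_neg_cancel, Real.exp_zero, mul_one]
            _ ≤ ℓ * Real.exp (-(N : ℝ) ^ u) :=
                mul_le_mul_of_nonneg_right hℓgt.le (Real.exp_pos _).le
            _ = Real.exp (-(N : ℝ) ^ u) * ℓ := mul_comm _ _

/-! ### Sparse families of translates -/

/-- **Roy's hypothesis restricted to any sparse family of translates is void.**  Let `s₀, s₁,
t₁ ≥ 0`, `σ ∈ ℝ`, `u ≥ 1`, `max(s₀, t₀, s₁ + t₁) ≤ u` and `s₀ + σ + u < 1 + t₀ + t₁`.  For every `l` and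
EVERY `y, α ∈ ℂ^l`, for all large `N` and every family `𝓜 ⊂ [0, N^{s₁}]^l` of at most `N^σ`
translation vectors there is `0 ≠ P_N` of Roy's profile (`deg ≤ (N^{t₀}, N^{t₁})`, `H ≤ e^N`) with
`|(D^k P_N)(Σ m_j y_j, Π α_j^{m_j})| ≤ e^{−N^u}` for all `k ≤ N^{s₀}` and all `m ∈ 𝓜` — the
hypothesis of Conjecture 2 with the box `[0, N^{s₁}]^l` replaced by `𝓜`.  The structure of `𝓜`
(sub-box, progression, lacunary, random) is irrelevant; only `#𝓜 ≤ N^σ` enters.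
(`royJets_void_of_pointCount` at the image points, which lie in the region `‖ξ‖ ≤ cN^{s₁}`,
`‖η‖ ≤ e^{cN^{s₁}}` with `c = Σ‖y_j‖ + log Π max(1, ‖α_j‖)`.) [this work] -/
theorem royJets_void_sparseTranslates {l : ℕ} (y α : Fin l → ℂ) {σ s₀ s₁ t₀ t₁ u : ℝ}
    (hs₀ : 0 ≤ s₀) (hs₁ : 0 ≤ s₁) (ht₁ : 0 ≤ t₁) (hu : 1 ≤ u) (hs₀u : s₀ ≤ u)
    (ht₀u : t₀ ≤ u) (hst : s₁ + t₁ ≤ u) (hdir : s₀ + σ + u < 1 + t₀ + t₁) :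
    ∀ᶠ N : ℕ in atTop, ∀ 𝓜 : Finset (Fin l → ℕ), (𝓜.card : ℝ) ≤ (N : ℝ) ^ σ →
      (∀ m ∈ 𝓜, ∀ j, (m j : ℝ) ≤ (N : ℝ) ^ s₁) →
      ∃ P : MvPolynomial (Fin 2) ℤ, P ≠ 0 ∧ (P.degreeOf 0 : ℝ) ≤ (N : ℝ) ^ t₀ ∧
        (P.degreeOf 1 : ℝ) ≤ (N : ℝ) ^ t₁ ∧ (mvPolyHeight P : ℝ) ≤ Real.exp N ∧
        ∀ k : ℕ, (k : ℝ) ≤ (N : ℝ) ^ s₀ → ∀ m ∈ 𝓜,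
          ‖aeval ![∑ j, (m j : ℂ) * y j, ∏ j, α j ^ m j] (royD^[k] P)‖ ≤
            Real.exp (-(N : ℝ) ^ u) := by
  classical
  set a : ℝ := ∏ j, max 1 ‖α j‖ with ha_def
  have ha : 1 ≤ a := Finset.prod_induction _ (fun x : ℝ => 1 ≤ x)
    (fun _ _ hx hy => one_le_mul_of_one_le_of_one_le hx hy) le_rfl (fun j _ => le_max_left _ _)
  have ha0 : 0 < a := by linarith
  set c : ℝ := (∑ j, ‖y j‖) + Real.log a with hc_def
  have hcy : 0 ≤ ∑ j, ‖y j‖ := Finset.sum_nonneg fun j _ => norm_nonneg _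
  have hloga : 0 ≤ Real.log a := Real.log_nonneg ha
  have hc : 0 ≤ c := by rw [hc_def]; positivity
  filter_upwards [royJets_void_of_pointCount hs₀ hs₁ ht₁ hu hs₀u ht₀u hst hdir hc]
    with N hN
  intro 𝓜 h𝓜 hbox
  have hN0 : (0 : ℝ) ≤ N := Nat.cast_nonneg N
  set M : ℕ := ⌊(N : ℝ) ^ s₁⌋₊ with hM_def
  have hM : (M : ℝ) ≤ (N : ℝ) ^ s₁ := Nat.floor_le (Real.rpow_nonneg hN0 _)
  -- the image point set
  set pt : (Fin l → ℕ) → ℂ × ℂ := fun m => (∑ j, (m j : ℂ) * y j, ∏ j, α j ^ m j) with hpt_def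
  set S : Finset (ℂ × ℂ) := 𝓜.image pt with hS_def
  have hScard : (S.card : ℝ) ≤ (N : ℝ) ^ σ :=
    le_trans (by exact_mod_cast Finset.card_image_le) h𝓜
  -- sizes of the image points
  have hsize : ∀ m ∈ 𝓜, ‖(pt m).1‖ ≤ c * (N : ℝ) ^ s₁ ∧
      ‖(pt m).2‖ ≤ Real.exp (c * (N : ℝ) ^ s₁) := by
    intro m hm
    have hmM : ∀ j, m j < M + 1 := fun j => Nat.lt_succ_of_le (Nat.le_floor (hbox m hm j))
    set i : Fin l → Fin (M + 1) := fun j => ⟨m j, hmM j⟩ with hi_def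
    have e1 : (pt m).1 = ∑ j, ((i j : ℕ) : ℂ) * y j := rfl
    have e2 : (pt m).2 = ∏ j, α j ^ (i j : ℕ) := rfl
    have hNs : 0 ≤ (N : ℝ) ^ s₁ := Real.rpow_nonneg hN0 _
    constructor
    · rw [e1]
      calc ‖∑ j, ((i j : ℕ) : ℂ) * y j‖ ≤ M * ∑ j, ‖y j‖ := norm_sum_natMul_le y i
        _ ≤ (N : ℝ) ^ s₁ * ∑ j, ‖y j‖ := mul_le_mul_of_nonneg_right hM hcy
        _ ≤ (N : ℝ) ^ s₁ * c := by
            refine mul_le_mul_of_nonneg_left ?_ hNs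
            rw [hc_def]; linarith
        _ = c * (N : ℝ) ^ s₁ := mul_comm _ _
    · rw [e2]
      calc ‖∏ j, α j ^ (i j : ℕ)‖ ≤ a ^ M := norm_prod_pow_le α i
        _ = Real.exp (M * Real.log a) := by rw [Real.exp_nat_mul, Real.exp_log ha0]
        _ ≤ Real.exp (c * (N : ℝ) ^ s₁) := by
            apply Real.exp_le_exp.2
            calc (M : ℝ) * Real.log a ≤ (N : ℝ) ^ s₁ * Real.log a :=
                  mul_le_mul_of_nonneg_right hM hloga
              _ ≤ (N : ℝ) ^ s₁ * c := by
                  refine mul_le_mul_of_nonneg_left ?_ hNs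
                  rw [hc_def]; linarith
              _ = c * (N : ℝ) ^ s₁ := mul_comm _ _
  have hξ : ∀ p ∈ S, ‖p.1‖ ≤ c * (N : ℝ) ^ s₁ := by
    intro p hp
    obtain ⟨m, hm, rfl⟩ := Finset.mem_image.1 hp
    exact (hsize m hm).1
  have hη : ∀ p ∈ S, ‖p.2‖ ≤ Real.exp (c * (N : ℝ) ^ s₁) := by
    intro p hp
    obtain ⟨m, hm, rfl⟩ := Finset.mem_image.1 hp
    exact (hsize m hm).2
  obtain ⟨P, hP0, hd0, hd1, hH, hjets⟩ := hN S hScard hξ hη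
  refine ⟨P, hP0, hd0, hd1, hH, fun k hk m hm => ?_⟩
  have hmem : pt m ∈ S := Finset.mem_image_of_mem pt hm
  exact hjets k hk (pt m) hmem

/-! ### On Roy's window -/

/-- On Roy's window the sparse-translate exponent `σ* = 1 + t₀ + t₁ − u − s₀` is positive
(`s₀ < u < (1 + t₀ + t₁)/2`). [this work] -/
theorem sparseExponent_pos {s₀ s₁ t₀ t₁ u : ℝ} (hadm : RoyAdmissible s₀ s₁ t₀ t₁ u) :
    0 < 1 + t₀ + t₁ - u - s₀ := by
  obtain ⟨hs₀, hs₁, ht₀, ht₁, hu, h1, h2, h3⟩ := hadm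
  have hs₀u : s₀ < u := lt_of_le_of_lt (le_max_left _ _) h2
  linarith

/-- … and smaller than `s₁`: the full box `[0, N^{s₁}]^l` always has more than `N^{σ*}` points,
already for `l = 1` (`dirichletExcess_pos_of_royAdmissible`). [this work] -/
theorem sparseExponent_lt {s₀ s₁ t₀ t₁ u : ℝ} (hadm : RoyAdmissible s₀ s₁ t₀ t₁ u) :
    1 + t₀ + t₁ - u - s₀ < s₁ := by
  have := dirichletExcess_pos_of_royAdmissible hadm
  linarith

/-- **On Roy's window, every family of fewer than `N^{σ*}` translates is void.**  For admissible
`(s₀, s₁, t₀, t₁, u)` (Roy 2001, condition (1)), every `σ < σ* = 1 + t₀ + t₁ − u − s₀`,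
every rank `l` and EVERY `y, α ∈ ℂ^l`: Roy's hypothesis restricted to any `≤ N^σ` translation
vectors `m ∈ [0, N^{s₁}]^l` holds.  Hence whatever a proof of Conjecture 2 (⟺ Schanuel's conjecture
in rank `l`, Roy) uses, it must exploit at least `N^{σ*}` translates jointly — and by
`royHypothesis_translationFree` / `SoloBlindOrbitCommonZeros.lean` not merely their number.
[this work] -/
theorem royJets_void_sparseTranslates_of_admissible {s₀ s₁ t₀ t₁ u : ℝ}
    (hadm : RoyAdmissible s₀ s₁ t₀ t₁ u) {σ : ℝ} (hσlt : σ < 1 + t₀ + t₁ - u - s₀)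
    {l : ℕ} (y α : Fin l → ℂ) :
    ∀ᶠ N : ℕ in atTop, ∀ 𝓜 : Finset (Fin l → ℕ), (𝓜.card : ℝ) ≤ (N : ℝ) ^ σ →
      (∀ m ∈ 𝓜, ∀ j, (m j : ℝ) ≤ (N : ℝ) ^ s₁) →
      ∃ P : MvPolynomial (Fin 2) ℤ, P ≠ 0 ∧ (P.degreeOf 0 : ℝ) ≤ (N : ℝ) ^ t₀ ∧
        (P.degreeOf 1 : ℝ) ≤ (N : ℝ) ^ t₁ ∧ (mvPolyHeight P : ℝ) ≤ Real.exp N ∧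
        ∀ k : ℕ, (k : ℝ) ≤ (N : ℝ) ^ s₀ → ∀ m ∈ 𝓜,
          ‖aeval ![∑ j, (m j : ℂ) * y j, ∏ j, α j ^ m j] (royD^[k] P)‖ ≤
            Real.exp (-(N : ℝ) ^ u) := by
  obtain ⟨hs₀, hs₁, ht₀, ht₁, hu, h1, h2, h3⟩ := hadm
  have hmax := max_lt_iff.1 h1
  have hmax' := max_lt_iff.1 hmax.2
  have h1s₀ : 1 < s₀ := lt_of_lt_of_le hmax.1 (min_le_left _ _)
  have ht₀s₀ : t₀ < s₀ := lt_of_lt_of_le hmax'.1 (min_le_left _ _)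
  have hs₀u : s₀ < u := lt_of_le_of_lt (le_max_left _ _) h2
  have hst : s₁ + t₁ < u := lt_of_le_of_lt (le_max_right _ _) h2
  exact royJets_void_sparseTranslates y α hs₀.le hs₁.le ht₁.le (by linarith) hs₀u.le
    (by linarith) hst.le (by linarith)

end Summit.Schanuel.Schanuel.Theorems

end
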